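import Summits.CriticalPhenomena.PercolationContinuityZ3.Theorems.SahiMasterFamilyPointwiseTransferSix
import Summits.CriticalPhenomena.PercolationContinuityZ3.Theorems.SahiMasterFamilyPrincipalCapLeSix
import Summits.CriticalPhenomena.PercolationContinuityZ3.Theorems.SahiMasterFamilyFaceVanishingAllOrders
import Summits.CriticalPhenomena.PercolationContinuityZ3.Theorems.SahiMasterFamilyPointwisePrincipalCapFive
import Summits.CriticalPhenomena.PercolationContinuityZ3.Theorems.SahiMasterFamilyPointwiseLowerFaceVanishing

/-!
# Pointwise (EQ-6): the order-six principal cap, and the pointwise master conjecture on every face-vanishing 6-family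

Unit `prim-master-conj` (crux anchor stmt-CriticalPhenomena-4575, helper work), gen 13.  Seat P4 proved `F(6)` (`PrincipalCapBeta.phiNonneg_six`,
`…PrincipalCapBetaSixMain`): `Φ_6(β) + 120(1 − β_⊤)` is a positive combination of 872 PRODUCTS of the atoms `β_S`, `1 − β_S`, `β_S − β_Aβ_B` (`A ∪ B = S`)
(pieces `piece1_eq … piece22_eq`, `phiSet_six`).  By the rigidity transfer of `…PointwiseTransfer` no comb lift is needed to harvest the pointwise statement:

* (`…PointwiseTransferSix`) `phiSet_six_transfer` — if the atoms transfer from `β` to `β'` (`β_⊤ = β'_⊤ = 1`), then `Φ_6(β) = 0 ⟹ Φ_6(β') = 0`;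
* `sahiE_six_ind_eq_zero_iff_of_principalCap` — **pointwise (EQ-6) on the principal-cap stratum**: for six increasing events whose common part is a principal
  up-set and `p` in the open cube, `E_6(μ_p; 1_U) = 0 ↔ U ∈ Z_6`; with P4's `C_6` there, `E_6(μ_p; 1_U) > 0` off `Z_6` (`sahiE_six_ind_pos_of_principalCap`);
* `sahiE_ind_eq_zero_iff_of_faceVanishing_of_principalCapPointwise` — the all-orders induction of `…FaceVanishingAllOrders` re-run with the POINTWISE
  principal-cap hypothesis (it only ever used the pointwise consequence of the comb certificates);
* **`sahiE_six_ind_eq_zero_iff_of_faceVanishing`, `sahiE_six_ind_pos_of_faceVanishing`, `sahiE_six_ind_nonneg_of_faceVanishing`** — for every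
  face-vanishing 6-family `U` (increasing, determined by `S`, all one-coordinate minors at `e ∈ S` in `Z_6`): Sahi's `C_6` holds (`E_6(μ_p;1_U) ≥ 0` for every
  `p`, from P4's `phiNonneg_six` through `sahiE_six_ind_nonneg_of_faceVanishing_of_phiNonneg`), and **at every interior `p`, `E_6(μ_p; 1_U) = 0 ↔ U ∈ Z_6`,
  `> 0` otherwise**.  With orders 3, 4, 5 (`…PointwiseFaceVanishing`, `…FaceVanishingPrincipalCap`, `…PointwisePrincipalCapFive`) the pointwise master
  conjecture and `C_k` hold on the whole face-vanishing class for every `k ≤ 6` (`sahiE_ind_eq_zero_iff_of_faceVanishing_of_le_six`,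
  `sahiE_ind_nonneg_of_faceVanishing_of_le_six`).
* every order from transferable certificates (`sahiE_ind_eq_zero_iff_of_faceVanishing_of_phiTransfer`: hypotheses `PT (j+4)`, `j ≤ n` — the input
  format for future `F(k)` certificates), and the DECREASING / GRAPH forms at orders `4, 5, 6` by complementation (`…_lower_…_of_le_two`,
  `sahiE_groupSep_…_of_le_two`: tuples of group separations `{X_j ↮ Y_j}` all of whose single-edge minors are zero flags).
* one statement for every `k ≤ 6` (`sahiE_ind_nonneg/eq_zero_iff/pos_of_faceVanishing_of_le_six`).
HONEST FRAMING: `MasterFamilyEqIff 6`, `C_6` in general and `F(7)` remain OPEN.  Axioms standard. [this work]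
-/

noncomputable section

open scoped Classical
open scoped unitInterval

namespace Summit.CriticalPhenomena.PercolationContinuityZ3.Theorems

open Finset Function
open Literature.Combinatorics.Sahi2008
open Literature.Probability.LatticeModels (isUpperSet_preimage_compl)
open Literature.Probability.Percolation (DeterminedBy determinedBy_iff)
open Literature.Probability.Percolation.DecisionTree (ind)
open SahiComb PrincipalCapBeta

namespace Pointwise

/-! ### 1. Pointwise (EQ-6) on the principal-cap stratum -/

section Events

variable {ι : Type} [Fintype ι]

/-- **Pointwise (EQ-6) on the principal-cap stratum**: for six increasing events whose common part is a principal up-set and `p` in the open cube,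
`E_6(μ_p; 1_U) = 0 ↔ U ∈ Z_6`. [this work] -/
theorem sahiE_six_ind_eq_zero_iff_of_principalCap (p : ι → unitInterval) (hp : ∀ e, (p e : ℝ) ∈ Set.Ioo (0 : ℝ) 1)
    (U : Fin 6 → Set (Set ι)) (hU : ∀ j, IsUpperSet (U j)) (c : Finset ι)
    (hpc : ∀ T : Set ι, (∀ j, T ∈ U j) ↔ (↑c : Set ι) ⊆ T) :
    sahiE (bernoulliWeight p) 6 (fun j => ind (U j)) = 0 ↔ SuppZeroFlag 6 U :=
  sahiE_ind_eq_zero_iff_of_principalCap_of_phiTransfer (k := 5)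
    (fun _ _ htop htop' hb hd hg h0 => phiSet_six_transfer htop htop' hb hd hg h0) hp U hU c hpc

/-- Strict form: a principal-cap 6-family outside `Z_6` has `E_6(μ_p; 1_U) > 0` at every interior `p` (sign from P4's `C_6` there). [this work] -/
theorem sahiE_six_ind_pos_of_principalCap (p : ι → unitInterval) (hp : ∀ e, (p e : ℝ) ∈ Set.Ioo (0 : ℝ) 1)
    (U : Fin 6 → Set (Set ι)) (hU : ∀ j, IsUpperSet (U j)) (c : Finset ι)
    (hpc : ∀ T : Set ι, (∀ j, T ∈ U j) ↔ (↑c : Set ι) ⊆ T) (hZ : ¬ SuppZeroFlag 6 U) :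
    0 < sahiE (bernoulliWeight p) 6 (fun j => ind (U j)) :=
  lt_of_le_of_ne (sahiE_six_ind_nonneg_of_principalCap ι p U hU c hpc)
    (fun h0 => hZ ((sahiE_six_ind_eq_zero_iff_of_principalCap p hp U hU c hpc).1 h0.symm))

/-! ### 2. Face-vanishing families: the all-orders induction with the pointwise principal-cap hypothesis -/

/-- **Pointwise (EQ-(n+4)) on every face-vanishing `(n+4)`-family, given pointwise (EQ) on principal-cap families of orders `4, …, n+4`** — the induction of
`sahiE_ind_eq_zero_iff_of_faceVanishing_of_principalCapComb` verbatim, with the comb hypothesis weakened to its pointwise consequence (which is all that proof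
used). [this work] -/
theorem sahiE_ind_eq_zero_iff_of_faceVanishing_of_principalCapPointwise :
    ∀ (n : ℕ), (∀ j, j ≤ n → ∀ (ι : Type) [Fintype ι] (q : ι → unitInterval), (∀ e, (q e : ℝ) ∈ Set.Ioo (0 : ℝ) 1) →
        ∀ (V : Fin (j + 4) → Set (Set ι)), (∀ i, IsUpperSet (V i)) →
        ∀ c : Finset ι, (∀ T : Set ι, (∀ i, T ∈ V i) ↔ (↑c : Set ι) ⊆ T) →
          sahiE (bernoulliWeight q) (j + 4) (fun i => ind (V i)) = 0 → SuppZeroFlag (j + 4) V) →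
      ∀ (ι : Type) [Fintype ι] (p : ι → unitInterval), (∀ e, (p e : ℝ) ∈ Set.Ioo (0 : ℝ) 1) →
        ∀ (U : Fin (n + 4) → Set (Set ι)) (S : Finset ι), (∀ j, IsUpperSet (U j)) → (∀ j, DeterminedBy (U j) (↑S : Set ι)) →
        (∀ e ∈ S, ∀ b : Bool, SuppZeroFlag (n + 4) (fun j => secAt e b (U j))) →
          (sahiE (bernoulliWeight p) (n + 4) (fun j => ind (U j)) = 0 ↔ SuppZeroFlag (n + 4) U) := by
  intro n
  induction n with
  | zero =>
    intro hPC ι _ p hp U S hU hUS hall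
    refine ⟨fun hz => ?_, fun hZ => masterFamilyEqIff_mpr 4 ι p U hZ⟩
    by_cases habs : ∃ j, ∀ l, l ≠ j → U l ⊆ U j
    · obtain ⟨j, hj⟩ := habs
      rw [sahiE_ind_eq_of_absorbing (bernoulliWeight p) (n := 2) U j hj] at hz
      have hE : sahiE (bernoulliWeight p) 3 (fun i => ind (U (j.succAbove i))) = 0 :=
        (mul_eq_zero.1 hz).resolve_left (absorbing_factor_pos p (U j) 1).ne'
      exact (suppZeroFlag_iff_erase_of_absorbing U hU j hj).2
        ((sahiE_three_ind_eq_zero_iff_of_faceVanishing ι p hp (fun i => U (j.succAbove i)) S (fun i => hU _) (fun i => hUS _)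
          (faceVanishing_erase_of_absorbing U S hU hall j hj)).1 hE)
    · push Not at habs
      by_cases hdel : ∃ m : Fin 4, SuppZeroFlag 3 (fun j => U (m.succAbove j))
      · obtain ⟨m, hm⟩ := hdel
        exact ((masterFamily_step_all p U hU m hm).2 hp).1 hz
      · push Not at hdel
        obtain ⟨hne, h0⟩ := nonempty_and_nonsure_of_noAbsorber U hU hdel habs
        obtain ⟨c, hcap⟩ := GluedFrames.principalCap_of_faceVanishing 0 ι U S hU hUS hne h0 hdel hall habs
        exact hPC 0 le_rfl ι p hp U hU c hcap hz
  | succ n ih =>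
    intro hPC ι _ p hp U S hU hUS hall
    have ih' := ih (fun j hj => hPC j (Nat.le_succ_of_le hj))
    refine ⟨fun hz => ?_, fun hZ => masterFamilyEqIff_mpr _ ι p U hZ⟩
    by_cases habs : ∃ j, ∀ l, l ≠ j → U l ⊆ U j
    · obtain ⟨j, hj⟩ := habs
      rw [sahiE_ind_eq_of_absorbing (bernoulliWeight p) (n := n + 3) U j hj] at hz
      have hE : sahiE (bernoulliWeight p) (n + 4) (fun i => ind (U (j.succAbove i))) = 0 :=
        (mul_eq_zero.1 hz).resolve_left (absorbing_factor_pos p (U j) (n + 2)).ne'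
      exact (suppZeroFlag_iff_erase_of_absorbing U hU j hj).2
        ((ih' ι p hp (fun i => U (j.succAbove i)) S (fun i => hU _) (fun i => hUS _)
          (faceVanishing_erase_of_absorbing U S hU hall j hj)).1 hE)
    · push Not at habs
      by_cases hdel : ∃ m : Fin (n + 1 + 4), SuppZeroFlag (n + 1 + 3) (fun j => U (m.succAbove j))
      · obtain ⟨m, hm⟩ := hdel
        exact ((masterFamily_step_all p U hU m hm).2 hp).1 hz
      · push Not at hdel
        obtain ⟨hne, h0⟩ := nonempty_and_nonsure_of_noAbsorber U hU hdel habs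
        obtain ⟨c, hcap⟩ := GluedFrames.principalCap_of_faceVanishing (n + 1) ι U S hU hUS hne h0 hdel hall habs
        exact hPC (n + 1) le_rfl ι p hp U hU c hcap hz

/-- The pointwise principal-cap hypothesis holds at orders `4, 5, 6` (comb certificates at `4, 5`; the transfer at `6`). [this work] -/
theorem principalCapPointwise_of_le_two (j : ℕ) (hj : j ≤ 2) (ι : Type) [Fintype ι] (q : ι → unitInterval)
    (hq : ∀ e, (q e : ℝ) ∈ Set.Ioo (0 : ℝ) 1) (V : Fin (j + 4) → Set (Set ι)) (hV : ∀ i, IsUpperSet (V i)) (c : Finset ι)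
    (hpc : ∀ T : Set ι, (∀ i, T ∈ V i) ↔ (↑c : Set ι) ⊆ T) (hz : sahiE (bernoulliWeight q) (j + 4) (fun i => ind (V i)) = 0) :
    SuppZeroFlag (j + 4) V := by
  interval_cases j
  · exact (sahiE_four_ind_eq_zero_iff_of_principalCap q hq V hV c hpc).1 hz
  · exact (sahiE_five_ind_eq_zero_iff_of_principalCap q hq V hV c hpc).1 hz
  · exact (sahiE_six_ind_eq_zero_iff_of_principalCap q hq V hV c hpc).1 hz

/-! ### 3. Order six on the face-vanishing class -/

/-- **Pointwise (EQ-6) on EVERY face-vanishing 6-family**: for six increasing events determined by `S` all of whose one-coordinate minors at `e ∈ S` lie in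
`Z_6`, and `p` in the open cube, `E_6(μ_p; 1_U) = 0 ↔ U ∈ Z_6`. [this work] -/
theorem sahiE_six_ind_eq_zero_iff_of_faceVanishing (p : ι → unitInterval) (hp : ∀ e, (p e : ℝ) ∈ Set.Ioo (0 : ℝ) 1)
    (U : Fin 6 → Set (Set ι)) (S : Finset ι) (hU : ∀ j, IsUpperSet (U j)) (hUS : ∀ j, DeterminedBy (U j) (↑S : Set ι))
    (hall : ∀ e ∈ S, ∀ b : Bool, SuppZeroFlag 6 (fun j => secAt e b (U j))) :
    sahiE (bernoulliWeight p) 6 (fun j => ind (U j)) = 0 ↔ SuppZeroFlag 6 U :=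
  sahiE_ind_eq_zero_iff_of_faceVanishing_of_principalCapPointwise 2 principalCapPointwise_of_le_two ι p hp U S hU hUS hall

/-- **Sahi's `C_6` on every face-vanishing 6-family** (every `p ∈ [0,1]^ι`): unconditional now that `F(6)` is P4's theorem `phiNonneg_six`. [this work] -/
theorem sahiE_six_ind_nonneg_of_faceVanishing (p : ι → unitInterval) (U : Fin 6 → Set (Set ι)) (S : Finset ι)
    (hU : ∀ j, IsUpperSet (U j)) (hUS : ∀ j, DeterminedBy (U j) (↑S : Set ι))
    (hall : ∀ e ∈ S, ∀ b : Bool, SuppZeroFlag 6 (fun j => secAt e b (U j))) :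
    0 ≤ sahiE (bernoulliWeight p) 6 (fun j => ind (U j)) :=
  sahiE_six_ind_nonneg_of_faceVanishing_of_phiNonneg phiNonneg_six p U S hU hUS hall

/-- **Strict form**: a face-vanishing 6-family outside `Z_6` has `E_6(μ_p; 1_U) > 0` at every interior `p`. [this work] -/
theorem sahiE_six_ind_pos_of_faceVanishing (p : ι → unitInterval) (hp : ∀ e, (p e : ℝ) ∈ Set.Ioo (0 : ℝ) 1)
    (U : Fin 6 → Set (Set ι)) (S : Finset ι) (hU : ∀ j, IsUpperSet (U j)) (hUS : ∀ j, DeterminedBy (U j) (↑S : Set ι))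
    (hall : ∀ e ∈ S, ∀ b : Bool, SuppZeroFlag 6 (fun j => secAt e b (U j))) (hZ : ¬ SuppZeroFlag 6 U) :
    0 < sahiE (bernoulliWeight p) 6 (fun j => ind (U j)) :=
  lt_of_le_of_ne (sahiE_six_ind_nonneg_of_faceVanishing p U S hU hUS hall)
    (fun h0 => hZ ((sahiE_six_ind_eq_zero_iff_of_faceVanishing p hp U S hU hUS hall).1 h0.symm))

/-! ### 4. Every order `k ≤ 6` on the face-vanishing class -/

/-- **`C_{n+4}` on every face-vanishing `(n+4)`-family for `n ≤ 2`** (orders `4, 5, 6`; P4's `phiNonneg_of_le_six`). [this work] -/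
theorem sahiE_ind_nonneg_of_faceVanishing_of_le_two {n : ℕ} (hn : n ≤ 2) (p : ι → unitInterval) (U : Fin (n + 4) → Set (Set ι))
    (S : Finset ι) (hU : ∀ j, IsUpperSet (U j)) (hUS : ∀ j, DeterminedBy (U j) (↑S : Set ι))
    (hall : ∀ e ∈ S, ∀ b : Bool, SuppZeroFlag (n + 4) (fun j => secAt e b (U j))) :
    0 ≤ sahiE (bernoulliWeight p) (n + 4) (fun j => ind (U j)) :=
  sahiE_ind_nonneg_of_faceVanishing_of_phiNonneg n (fun j hj => phiNonneg_of_le_six (by omega)) ι p U S hU hUS hall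

/-- **Pointwise (EQ-(n+4)) on every face-vanishing `(n+4)`-family for `n ≤ 2`** (orders `4, 5, 6`), `p` in the open cube. [this work] -/
theorem sahiE_ind_eq_zero_iff_of_faceVanishing_of_le_two {n : ℕ} (hn : n ≤ 2) (p : ι → unitInterval)
    (hp : ∀ e, (p e : ℝ) ∈ Set.Ioo (0 : ℝ) 1) (U : Fin (n + 4) → Set (Set ι)) (S : Finset ι) (hU : ∀ j, IsUpperSet (U j))
    (hUS : ∀ j, DeterminedBy (U j) (↑S : Set ι)) (hall : ∀ e ∈ S, ∀ b : Bool, SuppZeroFlag (n + 4) (fun j => secAt e b (U j))) :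
    sahiE (bernoulliWeight p) (n + 4) (fun j => ind (U j)) = 0 ↔ SuppZeroFlag (n + 4) U :=
  sahiE_ind_eq_zero_iff_of_faceVanishing_of_principalCapPointwise n (fun j hj => principalCapPointwise_of_le_two j (hj.trans hn))
    ι p hp U S hU hUS hall

/-- **Strict positivity off `Z`** on face-vanishing families of orders `4, 5, 6` at interior `p`. [this work] -/
theorem sahiE_ind_pos_of_faceVanishing_of_le_two {n : ℕ} (hn : n ≤ 2) (p : ι → unitInterval)
    (hp : ∀ e, (p e : ℝ) ∈ Set.Ioo (0 : ℝ) 1) (U : Fin (n + 4) → Set (Set ι)) (S : Finset ι) (hU : ∀ j, IsUpperSet (U j))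
    (hUS : ∀ j, DeterminedBy (U j) (↑S : Set ι)) (hall : ∀ e ∈ S, ∀ b : Bool, SuppZeroFlag (n + 4) (fun j => secAt e b (U j)))
    (hZ : ¬ SuppZeroFlag (n + 4) U) : 0 < sahiE (bernoulliWeight p) (n + 4) (fun j => ind (U j)) :=
  lt_of_le_of_ne (sahiE_ind_nonneg_of_faceVanishing_of_le_two hn p U S hU hUS hall)
    (fun h0 => hZ ((sahiE_ind_eq_zero_iff_of_faceVanishing_of_le_two hn p hp U S hU hUS hall).1 h0.symm))

/-! ### 5. Every order from transferable certificates -/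

/-- **Pointwise (EQ-(n+4)) on every face-vanishing `(n+4)`-family from TRANSFERABLE `F(j+4)`-certificates, `j ≤ n`** (the hypothesis `PT` of
`sahiE_ind_eq_zero_iff_of_principalCap_of_phiTransfer` at each order; at `n ≤ 2` these are theorems, and any future product-of-atoms certificate for
`F(7), F(8), …` discharges the next one by the walk of `…PointwiseTransferSix`). [this work] -/
theorem sahiE_ind_eq_zero_iff_of_faceVanishing_of_phiTransfer (n : ℕ)
    (PT : ∀ j, j ≤ n → ∀ β β' : Finset (Fin (j + 3 + 1)) → ℝ, β univ = 1 → β' univ = 1 →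
        (∀ B, 0 ≤ β B ∧ 0 ≤ β' B ∧ (β B = 0 → β' B = 0)) →
        (∀ B, 0 ≤ 1 - β B ∧ 0 ≤ 1 - β' B ∧ (1 - β B = 0 → 1 - β' B = 0)) →
        (∀ S A B : Finset (Fin (j + 3 + 1)), A ∪ B = S →
          0 ≤ β S - β A * β B ∧ 0 ≤ β' S - β' A * β' B ∧ (β S - β A * β B = 0 → β' S - β' A * β' B = 0)) →
        phiSet (j + 3 + 1) β = 0 → phiSet (j + 3 + 1) β' = 0)
    (p : ι → unitInterval) (hp : ∀ e, (p e : ℝ) ∈ Set.Ioo (0 : ℝ) 1) (U : Fin (n + 4) → Set (Set ι)) (S : Finset ι)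
    (hU : ∀ j, IsUpperSet (U j)) (hUS : ∀ j, DeterminedBy (U j) (↑S : Set ι))
    (hall : ∀ e ∈ S, ∀ b : Bool, SuppZeroFlag (n + 4) (fun j => secAt e b (U j))) :
    sahiE (bernoulliWeight p) (n + 4) (fun j => ind (U j)) = 0 ↔ SuppZeroFlag (n + 4) U :=
  sahiE_ind_eq_zero_iff_of_faceVanishing_of_principalCapPointwise n
    (fun j hj _ _ _ hq V hV c hpc hz => (sahiE_ind_eq_zero_iff_of_principalCap_of_phiTransfer (k := j + 3) (PT j hj) hq V hV c hpc).1 hz)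
    ι p hp U S hU hUS hall

/-! ### 6. Decreasing families and the graph form, orders `4, 5, 6` -/

/-- **`C_{n+4}` on every DECREASING face-vanishing `(n+4)`-family, `n ≤ 2`.** [this work] -/
theorem sahiE_ind_lower_nonneg_of_faceVanishing_of_le_two {n : ℕ} (hn : n ≤ 2) (p : ι → unitInterval)
    (D : Fin (n + 4) → Set (Set ι)) (S : Finset ι) (hD : ∀ j, IsLowerSet (D j)) (hDS : ∀ j, DeterminedBy (D j) (↑S : Set ι))
    (hall : ∀ e ∈ S, ∀ b : Bool, SuppZeroFlag (n + 4) (fun j => secAt e b (D j))) :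
    0 ≤ sahiE (bernoulliWeight p) (n + 4) (fun j => ind (D j)) :=
  sahiE_ind_lower_nonneg_of_faceVanishing_of_phiNonneg n (fun j hj => phiNonneg_of_le_six (by omega)) p D S hD hDS hall

/-- **Pointwise zero locus of a DECREASING face-vanishing `(n+4)`-family, `n ≤ 2`**: `E = 0 ↔ Z` at every interior `p`. [this work] -/
theorem sahiE_ind_lower_eq_zero_iff_of_faceVanishing_of_le_two {n : ℕ} (hn : n ≤ 2) (p : ι → unitInterval)
    (hp : ∀ e, (p e : ℝ) ∈ Set.Ioo (0 : ℝ) 1) (D : Fin (n + 4) → Set (Set ι)) (S : Finset ι) (hD : ∀ j, IsLowerSet (D j))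
    (hDS : ∀ j, DeterminedBy (D j) (↑S : Set ι)) (hall : ∀ e ∈ S, ∀ b : Bool, SuppZeroFlag (n + 4) (fun j => secAt e b (D j))) :
    sahiE (bernoulliWeight p) (n + 4) (fun j => ind (D j)) = 0 ↔ SuppZeroFlag (n + 4) D := by
  rw [sahiE_ind_eq_sahiE_ind_preimage_compl, ← suppZeroFlag_preimage_compl_iff (n + 4) D]
  exact sahiE_ind_eq_zero_iff_of_faceVanishing_of_le_two hn _ ((symm_mem_Ioo_iff p).2 hp) (fun j => compl ⁻¹' D j) S
    (fun j => isUpperSet_preimage_compl (hD j)) (fun j => (determinedBy_preimage_compl_iff (D j) _).2 (hDS j))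
    (faceVanishing_preimage_compl D S hall)

end Events

section Graph

open Literature.Probability.Percolation

variable {V : Type} [Fintype V]

/-- **Graph form, `C_{n+4}` (`n ≤ 2`)**: for `n+4` group separations `{X_j ↮ Y_j}` on a finite graph all of whose single-edge minors are zero flags,
`E_{n+4}(μ_w; …) ≥ 0` for every edge-weight vector `w`. [this work] -/
theorem sahiE_groupSep_nonneg_of_faceVanishing_of_le_two {n : ℕ} (hn : n ≤ 2) (w : Sym2 V → unitInterval)
    (X Y : Fin (n + 4) → Set V)
    (hall : ∀ (e : Sym2 V) (b : Bool), SuppZeroFlag (n + 4) (fun j =>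
      secAt e b {ω : BondConfig V | ∀ x ∈ X j, ∀ y ∈ Y j, ¬ (openGraph ω).Reachable x y})) :
    0 ≤ sahiE (bernoulliWeight w) (n + 4) (fun j => ind {ω : BondConfig V | ∀ x ∈ X j, ∀ y ∈ Y j, ¬ (openGraph ω).Reachable x y}) :=
  sahiE_ind_lower_nonneg_of_faceVanishing_of_le_two hn w _ univ (fun j => isLowerSet_groupSep (X j) (Y j))
    (fun j => by rw [coe_univ, determinedBy_iff]; intro ω ω' h; rw [Set.inter_univ, Set.inter_univ] at h; rw [h])
    (fun e _ b => hall e b)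

/-- **Graph form, pointwise (`n ≤ 2`)**: with every single-edge minor a zero flag, at every interior weight vector `E_{n+4} = 0` iff the tuple of
group separations is itself a zero flag; `> 0` otherwise. [this work] -/
theorem sahiE_groupSep_eq_zero_iff_of_faceVanishing_of_le_two {n : ℕ} (hn : n ≤ 2) (w : Sym2 V → unitInterval)
    (hw : ∀ e, (w e : ℝ) ∈ Set.Ioo (0 : ℝ) 1) (X Y : Fin (n + 4) → Set V)
    (hall : ∀ (e : Sym2 V) (b : Bool), SuppZeroFlag (n + 4) (fun j =>
      secAt e b {ω : BondConfig V | ∀ x ∈ X j, ∀ y ∈ Y j, ¬ (openGraph ω).Reachable x y})) :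
    sahiE (bernoulliWeight w) (n + 4) (fun j => ind {ω : BondConfig V | ∀ x ∈ X j, ∀ y ∈ Y j, ¬ (openGraph ω).Reachable x y}) = 0 ↔
      SuppZeroFlag (n + 4) fun j => {ω : BondConfig V | ∀ x ∈ X j, ∀ y ∈ Y j, ¬ (openGraph ω).Reachable x y} :=
  sahiE_ind_lower_eq_zero_iff_of_faceVanishing_of_le_two hn w hw _ univ (fun j => isLowerSet_groupSep (X j) (Y j))
    (fun j => by rw [coe_univ, determinedBy_iff]; intro ω ω' h; rw [Set.inter_univ, Set.inter_univ] at h; rw [h])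
    (fun e _ b => hall e b)

end Graph

/-! ### 7. One statement for every order `k ≤ 6` -/

section AllSix

variable {ι : Type} [Fintype ι]

/-- **Sahi's `C_k` on the face-vanishing class for every `k ≤ 6`** (orders `≤ 2`: every family; `3`: `…FaceVanishingC3`; `4, 5, 6`: P4's `F(k)`). [this work] -/
theorem sahiE_ind_nonneg_of_faceVanishing_of_le_six {k : ℕ} (hk : k ≤ 6) (p : ι → unitInterval) (U : Fin k → Set (Set ι))
    (S : Finset ι) (hU : ∀ j, IsUpperSet (U j)) (hUS : ∀ j, DeterminedBy (U j) (↑S : Set ι))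
    (hall : ∀ e ∈ S, ∀ b : Bool, SuppZeroFlag k (fun j => secAt e b (U j))) :
    0 ≤ sahiE (bernoulliWeight p) k (fun j => ind (U j)) := by
  rcases Nat.lt_or_ge k 3 with h3 | h3
  · exact masterFamilyNonneg_of_le_two (by omega) ι p U hU
  · obtain ⟨n, rfl⟩ : ∃ n, k = n + 3 := ⟨k - 3, by omega⟩
    rcases n with _ | n
    · exact sahiE_three_nonneg_of_faceVanishing ι p U S hU hUS hall
    · exact sahiE_ind_nonneg_of_faceVanishing_of_le_two (n := n) (by omega) p U S hU hUS hall

/-- **The pointwise master conjecture on the face-vanishing class for every `k ≤ 6`**: for `k ≤ 6` increasing events determined by `S` all of whose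
one-coordinate minors at `e ∈ S` lie in `Z_k`, and `p` in the open cube, `E_k(μ_p; 1_U) = 0 ↔ U ∈ Z_k`. [this work] -/
theorem sahiE_ind_eq_zero_iff_of_faceVanishing_of_le_six {k : ℕ} (hk : k ≤ 6) (p : ι → unitInterval)
    (hp : ∀ e, (p e : ℝ) ∈ Set.Ioo (0 : ℝ) 1) (U : Fin k → Set (Set ι)) (S : Finset ι) (hU : ∀ j, IsUpperSet (U j))
    (hUS : ∀ j, DeterminedBy (U j) (↑S : Set ι)) (hall : ∀ e ∈ S, ∀ b : Bool, SuppZeroFlag k (fun j => secAt e b (U j))) :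
    sahiE (bernoulliWeight p) k (fun j => ind (U j)) = 0 ↔ SuppZeroFlag k U := by
  rcases Nat.lt_or_ge k 3 with h3 | h3
  · exact masterFamilyEqIff_of_le_two (by omega) ι p hp U hU
  · obtain ⟨n, rfl⟩ : ∃ n, k = n + 3 := ⟨k - 3, by omega⟩
    rcases n with _ | n
    · exact sahiE_three_ind_eq_zero_iff_of_faceVanishing ι p hp U S hU hUS hall
    · exact sahiE_ind_eq_zero_iff_of_faceVanishing_of_le_two (n := n) (by omega) p hp U S hU hUS hall

/-- **Strict positivity off `Z_k`, every `k ≤ 6`**, on the face-vanishing class at interior `p`. [this work] -/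
theorem sahiE_ind_pos_of_faceVanishing_of_le_six {k : ℕ} (hk : k ≤ 6) (p : ι → unitInterval)
    (hp : ∀ e, (p e : ℝ) ∈ Set.Ioo (0 : ℝ) 1) (U : Fin k → Set (Set ι)) (S : Finset ι) (hU : ∀ j, IsUpperSet (U j))
    (hUS : ∀ j, DeterminedBy (U j) (↑S : Set ι)) (hall : ∀ e ∈ S, ∀ b : Bool, SuppZeroFlag k (fun j => secAt e b (U j)))
    (hZ : ¬ SuppZeroFlag k U) : 0 < sahiE (bernoulliWeight p) k (fun j => ind (U j)) :=
  lt_of_le_of_ne (sahiE_ind_nonneg_of_faceVanishing_of_le_six hk p U S hU hUS hall)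
    (fun h0 => hZ ((sahiE_ind_eq_zero_iff_of_faceVanishing_of_le_six hk p hp U S hU hUS hall).1 h0.symm))

end AllSix

end Pointwise

end Summit.CriticalPhenomena.PercolationContinuityZ3.Theorems
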